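import Mathlib
import Summits.ValiantsHypothesis.ValiantsHypothesis.Theorems.NewtonTauWeak.Negative.Zonogon
import Summits.ValiantsHypothesis.ValiantsHypothesis.Theorems.NewtonUnitEquationsNewtonTauWeakAutomatonRadixDefs
import Summits.ValiantsHypothesis.ValiantsHypothesis.Theorems.NewtonUnitEquationsNewtonTauWeakAutomatonRadixAssembly
import Summits.ValiantsHypothesis.ValiantsHypothesis.Theorems.NewtonUnitEquationsNewtonTauWeakDigitFrame

/-!
# `NewtonUnitEquationsNewtonTauWeakRadixFrame` — THEOREM C in (near-)crux language: every MIXED-RADIX DIGIT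
# FRAME (crux `NewtonTauWeak`, stmt-ValiantsHypothesis-5904; line `binomial-normal-form`, registered stubs
# `stub_radixFrameQuasiPoly` and `stub_radixFrameQuasiShape`)

`stub_radixFrameQuasiPoly`: `k` products of `m` factors `f_{lj} = g_{lj}(x^{bx^{lev j}}, y^{by^{lev j}})`
(`radExpand (bx ^ lev j) (by ^ lev j)`, radix pair `bx, by ≥ 2`), at most `r` factors on each of the `n` levels,
digit polynomials `g_{lj}` of degree `≤ c` in each variable:
`vert(Σ_l Π_j f_{lj}) ≤ (rc+1)² · (bx·by) · A^{⌈log₂ n⌉}`, `A = 4D³ + 2D² + 2D + 2`, `D = (k (rc+1)⁴)²` — uniformly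
in `k`.  Proof (verbatim the regrouping of `stub_digitFrameQuasiPoly`, `…NewtonTauWeakDigitFrame.lean`, radix
`(2, 2)`): regroup each product by level (`Finset.prod_fiberwise_of_maps_to` along `j ↦ lev j`, `map_prod` for the
algebra map `radExpand`): `Π_j f_{lj} = radProd bx by (G l) n` with the level polynomial `G l i = Π_{lev j = i} g_{lj}`,
of degree `≤ r c` in each variable (`DigitFrameAux.support_level_le`); the sum is `radSum bx by k n 1 G`
(`C 1 = 1`), and THEOREM C (`stub_radAssembly`, `…AutomatonRadixAssembly.lean`) with `C = r c` is exactly the claim.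

`stub_radixFrameQuasiShape`: the same bound in the admissible quasi shape `bx·by·(k (rc+1) + 2)^{36 ⌈log₂ (n+2)⌉}`
(logarithm on the number of LEVELS only).  Arithmetic from the first statement: `k = 0` is the empty sum
(`vert 0 = 0`); for `k ≥ 1` put `u = rc+1`, `X = k u + 2 ≥ 2`: `u ≤ X`, `D ≤ X^{10}`, `A ≤ 10 X^{30} ≤ X^{34}`,
`⌈log₂ n⌉ ≤ ⌈log₂(n+2)⌉ ≥ 1`, so `u² · A^{⌈log₂ n⌉} ≤ X² · X^{34⌈log₂(n+2)⌉} ≤ X^{36 ⌈log₂(n+2)⌉}`.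
[folklore: mixed-radix carry automaton + Theorem Q's product step, regrouped by level]
-/

set_option linter.dupNamespace false

noncomputable section

open scoped BigOperators
open MvPolynomial
open Summit.ValiantsHypothesis.ValiantsHypothesis.Theorems.NewtonTauWeak.Negative (vert vert_le_card_support)

namespace Summit.ValiantsHypothesis.ValiantsHypothesis.Theorems.NewtonTauWeakAutomaton

namespace RadixFrameAux

-- adapted from NewtonUnitEquationsNewtonTauWeakDigitFrame.lean (`DigitFrameAux.prod_expand_eq_genProd`,
-- `DigitFrameAux.arith_shape`, radix `(2, 2)`)

/-- **Regrouping a mixed-radix digit frame by level.** A product of radix-scaled factors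
`radExpand (bx ^ lev j) (by ^ lev j) (f j)` over `j : Fin m` is the `n`-level mixed-radix product `radProd bx by` of
the level polynomials `Π_{lev j = i} f j` (the level polynomial of a level `i ≥ n` is `1`): `radExpand a b` is an
algebra map (`map_prod`) and the factors are regrouped along the fibres of `j ↦ lev j`
(`Finset.prod_fiberwise_of_maps_to`). [folklore] -/
theorem prod_radExpand_eq_radProd (bx by' m n : ℕ) (lev : Fin m → Fin n) (f : Fin m → MvPolynomial (Fin 2) ℂ) :
    ∏ j, radExpand (bx ^ (lev j : ℕ)) (by' ^ (lev j : ℕ)) (f j) =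
      radProd bx by'
        (fun i : ℕ => if h : i < n then ∏ j ∈ Finset.univ.filter (fun j => lev j = ⟨i, h⟩), f j else 1) n := by
  unfold radProd
  rw [← Finset.prod_fiberwise_of_maps_to (s := Finset.univ) (t := Finset.range n) (g := fun j => (lev j : ℕ))
    (fun j _ => Finset.mem_range.mpr (lev j).isLt)]
  refine Finset.prod_congr rfl fun i hi => ?_
  rw [Finset.mem_range] at hi
  dsimp only
  rw [dif_pos hi, map_prod]
  refine Finset.prod_congr ?_ ?_
  · ext j
    simp [Fin.ext_iff]
  · intro j hj
    simp only [Finset.mem_filter, Finset.mem_univ, true_and] at hj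
    rw [hj]

/-- **The arithmetic of the admissible quasi shape (mixed radix).**  For `k, u, L ≥ 1`, `c' ≤ L` and any `B`
(here `B = bx·by`), with `D = (k u⁴)²` and `A = 4D³ + 2D² + 2D + 2`: `u² · (B · A^{c'}) ≤ B · (k u + 2)^{36 L}`
(put `X = k u + 2 ≥ 2`: `u, k ≤ X`, `D ≤ X^{10}`, `A ≤ 10 X^{30} ≤ X^{34}`, `u² ≤ X² ≤ X^{2L}`).  Stated with a clean
context (only naturals), so that it can be applied after the polynomial bound. -/
theorem arith_shape (k u L c' B : ℕ) (hk : 1 ≤ k) (hu1 : 1 ≤ u) (hc1 : c' ≤ L) (hc2 : 1 ≤ L) :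
    u * u * (B * (4 * (k * (u * u * (u * u)) * (k * (u * u * (u * u)))) ^ 3 +
      2 * (k * (u * u * (u * u)) * (k * (u * u * (u * u)))) ^ 2 +
      2 * (k * (u * u * (u * u)) * (k * (u * u * (u * u)))) + 2) ^ c') ≤ B * (k * u + 2) ^ (36 * L) := by
  set D : ℕ := k * (u * u * (u * u)) * (k * (u * u * (u * u))) with hD
  set A : ℕ := 4 * D ^ 3 + 2 * D ^ 2 + 2 * D + 2 with hA
  set X : ℕ := k * u + 2 with hX
  have hX2 : 2 ≤ X := Nat.le_add_left 2 (k * u)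
  have hX1 : 1 ≤ X := le_trans one_le_two hX2
  have huX : u ≤ X :=
    calc u = 1 * u := (one_mul u).symm
      _ ≤ k * u := Nat.mul_le_mul_right u hk
      _ ≤ k * u + 2 := Nat.le_add_right _ _
  have hkX : k ≤ X :=
    calc k = k * 1 := (mul_one k).symm
      _ ≤ k * u := Nat.mul_le_mul_left k hu1
      _ ≤ k * u + 2 := Nat.le_add_right _ _
  have hDX : D ≤ X ^ 10 := by
    have h5 : k * (u * u * (u * u)) ≤ X ^ 5 :=
      calc k * (u * u * (u * u)) ≤ X * (X * X * (X * X)) :=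
            Nat.mul_le_mul hkX (Nat.mul_le_mul (Nat.mul_le_mul huX huX) (Nat.mul_le_mul huX huX))
        _ = X ^ 5 := by ring
    calc D = k * (u * u * (u * u)) * (k * (u * u * (u * u))) := rfl
      _ ≤ X ^ 5 * X ^ 5 := Nat.mul_le_mul h5 h5
      _ = X ^ 10 := by rw [← pow_add]
  have hAX : A ≤ X ^ 34 := by
    have hD3 : D ^ 3 ≤ X ^ 30 :=
      calc D ^ 3 ≤ (X ^ 10) ^ 3 := Nat.pow_le_pow_left hDX 3
        _ = X ^ 30 := by rw [← pow_mul]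
    have hD2 : D ^ 2 ≤ X ^ 30 :=
      calc D ^ 2 ≤ (X ^ 10) ^ 2 := Nat.pow_le_pow_left hDX 2
        _ = X ^ 20 := by rw [← pow_mul]
        _ ≤ X ^ 30 := Nat.pow_le_pow_right hX1 (by norm_num)
    have hD1 : D ≤ X ^ 30 := hDX.trans (Nat.pow_le_pow_right hX1 (by norm_num))
    have h30 : 1 ≤ X ^ 30 := Nat.one_le_pow _ _ hX1
    have h10 : 10 ≤ X ^ 4 :=
      calc 10 ≤ 2 ^ 4 := by norm_num
        _ ≤ X ^ 4 := Nat.pow_le_pow_left hX2 4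
    calc A = 4 * D ^ 3 + 2 * D ^ 2 + 2 * D + 2 := rfl
      _ ≤ 4 * X ^ 30 + 2 * X ^ 30 + 2 * X ^ 30 + 2 * X ^ 30 := by omega
      _ = 10 * X ^ 30 := by ring
      _ ≤ X ^ 4 * X ^ 30 := Nat.mul_le_mul_right _ h10
      _ = X ^ 34 := by rw [← pow_add]
  have h2 : u * u ≤ X ^ 2 :=
    calc u * u ≤ X * X := Nat.mul_le_mul huX huX
      _ = X ^ 2 := (sq X).symm
  have hX34 : 1 ≤ X ^ 34 := Nat.one_le_pow _ _ hX1
  calc u * u * (B * A ^ c') = B * (u * u * A ^ c') := by ring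
    _ ≤ B * (X ^ 2 * (X ^ 34) ^ L) :=
        Nat.mul_le_mul_left B
          (Nat.mul_le_mul h2 ((Nat.pow_le_pow_left hAX _).trans (Nat.pow_le_pow_right hX34 hc1)))
    _ = B * (X ^ 2 * X ^ (34 * L)) := by rw [← pow_mul]
    _ ≤ B * (X ^ (2 * L) * X ^ (34 * L)) :=
        Nat.mul_le_mul_left B
          (Nat.mul_le_mul_right _ (Nat.pow_le_pow_right hX1 (Nat.le_mul_of_pos_right 2 hc2)))
    _ = B * X ^ (36 * L) := by rw [← pow_add, show 2 * L + 34 * L = 36 * L by ring]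

end RadixFrameAux

/-! ## THEOREM C on every mixed-radix digit frame -/

/-- **THEOREM C in (near-)crux language: every MIXED-RADIX DIGIT FRAME, uniformly in `k`.**  For a radix pair
`bx, by ≥ 2`, `k` products of `m` factors `f_{lj} = g_{lj}(x^{bx^{lev j}}, y^{by^{lev j}})`
(`radExpand (bx ^ lev j) (by ^ lev j) (g l j)`) with at most `r` factors on each of the `n` levels and digit
polynomials `g l j` of degree `≤ c` in each variable,
`vert(Σ_l Π_j f_{lj}) ≤ (rc+1)² · (bx·by) · A^{⌈log₂ n⌉}`, `A = 4D³ + 2D² + 2D + 2`, `D = (k (rc+1)⁴)²`.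
Proof: regroup by level (`RadixFrameAux.prod_radExpand_eq_radProd`): `Π_j f_{lj} = radProd bx by (G l) n` with
`G l i = Π_{lev j = i} g_{lj}` of degree `≤ r c` in each variable (`DigitFrameAux.support_level_le`), the sum is
`radSum bx by k n 1 G` (`C 1 = 1`), then THEOREM C `stub_radAssembly` with `C = r c`. [folklore] -/
theorem stub_radixFrameQuasiPoly (bx by' k m n r c : ℕ) (hbx : 2 ≤ bx) (hby : 2 ≤ by') (lev : Fin m → Fin n)
    (hmult : ∀ i : Fin n, (Finset.univ.filter fun j => lev j = i).card ≤ r)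
    (g : Fin k → Fin m → MvPolynomial (Fin 2) ℂ) (hdeg : ∀ l j, ∀ e ∈ (g l j).support, e 0 ≤ c ∧ e 1 ≤ c) :
    vert (∑ l, ∏ j, radExpand (bx ^ (lev j : ℕ)) (by' ^ (lev j : ℕ)) (g l j)) ≤ (r * c + 1) * (r * c + 1) * (bx * by' *
      (4 * (k * ((r * c + 1) * (r * c + 1) * ((r * c + 1) * (r * c + 1))) *
            (k * ((r * c + 1) * (r * c + 1) * ((r * c + 1) * (r * c + 1))))) ^ 3 +
        2 * (k * ((r * c + 1) * (r * c + 1) * ((r * c + 1) * (r * c + 1))) *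
            (k * ((r * c + 1) * (r * c + 1) * ((r * c + 1) * (r * c + 1))))) ^ 2 +
        2 * (k * ((r * c + 1) * (r * c + 1) * ((r * c + 1) * (r * c + 1))) *
            (k * ((r * c + 1) * (r * c + 1) * ((r * c + 1) * (r * c + 1))))) + 2) ^
      Nat.clog 2 n) := by
  have hsum : (∑ l, ∏ j, radExpand (bx ^ (lev j : ℕ)) (by' ^ (lev j : ℕ)) (g l j)) =
      radSum bx by' k n (fun _ => (1 : ℂ)) (fun l i => if h : i < n then
        ∏ j ∈ Finset.univ.filter (fun j => lev j = ⟨i, h⟩), g l j else 1) := by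
    unfold radSum
    refine Finset.sum_congr rfl fun l _ => ?_
    simp only [C_1, one_mul]
    exact RadixFrameAux.prod_radExpand_eq_radProd bx by' m n lev (g l)
  rw [hsum]
  exact stub_radAssembly bx by' k (r * c) n hbx hby (fun _ => 1) _
    (fun l i => DigitFrameAux.support_level_le m n r c lev hmult (g l) (hdeg l) i)

/-- **The mixed-radix digit-frame bound in the admissible quasi shape.**  Under the hypotheses of
`stub_radixFrameQuasiPoly`, `vert(Σ_l Π_j f_{lj}) ≤ bx·by·(k (rc+1) + 2)^{36 ⌈log₂ (n+2)⌉}` — quasi-polynomial with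
the logarithm on the number of LEVELS only.  Arithmetic from `stub_radixFrameQuasiPoly`: `k = 0` is the empty sum
(`vert 0 = 0` by `vert_le_card_support`); for `k ≥ 1`, with `u = rc+1` and `X = k u + 2 ≥ 2`: `u, k ≤ X`,
`D ≤ X^{10}`, `A ≤ 10 X^{30} ≤ X^{34}`, `u² ≤ X²`, `⌈log₂ n⌉ ≤ ⌈log₂(n+2)⌉ ≥ 1`, hence
`u² · A^{⌈log₂ n⌉} ≤ X² (X^{34})^{⌈log₂(n+2)⌉} ≤ X^{36 ⌈log₂(n+2)⌉}` (`RadixFrameAux.arith_shape`). [folklore] -/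
theorem stub_radixFrameQuasiShape (bx by' k m n r c : ℕ) (hbx : 2 ≤ bx) (hby : 2 ≤ by') (lev : Fin m → Fin n)
    (hmult : ∀ i : Fin n, (Finset.univ.filter fun j => lev j = i).card ≤ r)
    (g : Fin k → Fin m → MvPolynomial (Fin 2) ℂ) (hdeg : ∀ l j, ∀ e ∈ (g l j).support, e 0 ≤ c ∧ e 1 ≤ c) :
    vert (∑ l, ∏ j, radExpand (bx ^ (lev j : ℕ)) (by' ^ (lev j : ℕ)) (g l j)) ≤
      bx * by' * (k * (r * c + 1) + 2) ^ (36 * Nat.clog 2 (n + 2)) := by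
  rcases Nat.eq_zero_or_pos k with hk | hk
  · -- no products: the sum is `0`, which has no vertices
    subst hk
    have h0 : (∑ l : Fin 0, ∏ j, radExpand (bx ^ (lev j : ℕ)) (by' ^ (lev j : ℕ)) (g l j)) = 0 :=
      Fin.sum_univ_zero _
    rw [h0]
    have h := vert_le_card_support (0 : MvPolynomial (Fin 2) ℂ)
    rw [MvPolynomial.support_zero, Finset.card_empty] at h
    exact h.trans (Nat.zero_le _)
  · exact (stub_radixFrameQuasiPoly bx by' k m n r c hbx hby lev hmult g hdeg).trans
      (RadixFrameAux.arith_shape k (r * c + 1) (Nat.clog 2 (n + 2)) (Nat.clog 2 n) (bx * by') hk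
        (Nat.le_add_left 1 _) (Nat.clog_mono_right 2 (Nat.le_add_right n 2))
        (Nat.clog_pos one_lt_two (Nat.lt_of_lt_of_le one_lt_two (Nat.le_add_left 2 n))))

end Summit.ValiantsHypothesis.ValiantsHypothesis.Theorems.NewtonTauWeakAutomaton

end
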